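import Summits.HodgeConjecture.HodgeConjecture.Theorems.F0P3bPrincipalSeriesTrace     -- ★ p840990: `smoothTrace_comp_eq_add_of_constituents_eq_pair` (+ `IsLocSmooth`, `OneDimAutRepH`)
import Summits.HodgeConjecture.HodgeConjecture.Theorems.F0P3bCharDistReduction        -- ★ `nonarchimedeanGroup_HLoc`, `MonoidHom.isLocallyConstant_of_continuous_unitsComplex`
import Literature.NumberTheory.Automorphic.UnitaryGroupPrincipalSeriesHLattice         -- ★ p841887 H0: `hLengthTwoLabels_boxChar`, `subrepresentationCMPrincipalSeriesHOrderIso`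
import Literature.NumberTheory.Automorphic.CMPrincipalSeriesHAdmissible                 -- ★ B-p18 (g31): `isAdmissible_cmPrincipalSeriesH` (Iwasawa ⇒ `i(χH₂)` admissible ⇒ its box with `χH₁`)
import Literature.NumberTheory.Automorphic.IrreducibleClassesComapInner               -- ★ `IrrClass.comap_refl`
import Literature.NumberTheory.Automorphic.CMPrincipalSeriesJacquetEvalOne              -- ★ `nonarchimedeanGroup_unitaryGroupOfForm_local`
import Literature.NumberTheory.Rogawski1990.XiLocalCharacter                           -- ★ `OneDimAutRepH.xiLocalChar`, `xiLocalChar_apply_eq`, `continuous_xiLocalChar`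
import HarnessLib

/-!
# (N-H-ii′) REDUCED TO `U(1,1)`: `stub_hPrincipalSeriesJH` of line «CMCharIdentityTest» (ED. 10) follows from the Jordan–Hölder statement for
# `i(χH₂) = cmPrincipalSeries L 2 v χH₂` on `U(Φ₂)(L⁺_v)` ALONE

Cell hodgecm-mathlib F0∕P2 (free hand F0P2-p06 (g6) draft ∕ (g7) completion, for the F0∕P3b desk), crux `stmt-HodgeConjecture-24833` (`H413`), line
«CMCharIdentityTest» (`Cruxes/H413/Lines/F0_P3b_CMCharIdentityTestPaydown.lean` ED. 11), road H0–H5 of the (N-H-ii) census, step **H5 (assembly) done in advance**: with H0 ★ (`IrreducibleClassesBoxChar`, `UnitaryGroupPrincipalSeriesHLattice`), H2 ★ and the generic ★ inputs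
(`isAdmissible_cmPrincipalSeries_of_iwasawa` + `exists_borel_mul_mem_cmLocalIntegralLevel`, ★ `smoothTrace_comp_eq_add_of_constituents_eq_pair`), the
`H_v`-statement `stub_hPrincipalSeriesJH` (labels `{⟦ξ_v⟧, πSt}` of `i_H(χH₂ ⊠ χH₁)` + additivity of its character) is a CONSEQUENCE of ONE statement about
the rank-one quasi-split group `U(Φ₂)(L⁺_v) ≅ U(1,1)`:

  **(JH₂)** for every CM `L`, finite `v` non-split in `L`, one-dimensional `ξ = (η, ψ)`, and every proof `hξ₂` that `ξ₂ := ξ_v ∘ inl` has open kernel: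
  `∃ πSt₂ ≠ ⟦ℂ_{ξ₂}⟧` with (a) the constituents of `i(χH₂)` are EXACTLY `{⟦ℂ_{ξ₂}⟧, πSt₂}` and (b) `i(χH₂)` has no chain `⊥ < N₁ < N₂ < ⊤` of stable
  subspaces (length ≤ 2) — [Rogawski1990, §12.1 case (1)] for `U(2) × U(1)` read on its `U(2)`-factor (`χH₂ = ξ₂|_T · ‖·‖_E^{1∕2}`).

`hPrincipalSeriesJH_of_uTwo : (JH₂) → (the statement of stub_hPrincipalSeriesJH, abbreviations `Pl`∕`HLoc` unfolded)` — the desk folds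
`stub_hPrincipalSeriesJH := F0P3bHPrincipalSeriesJHOfUTwo.hPrincipalSeriesJH_of_uTwo ‹(JH₂) closer›` once (JH₂) lands (poles H1 Jacquet filtration of
`i(χH₂)` for `U(Φ₂)`, H3 `r_B ≠ 0` on constituents, H4 the quotient `i(χH₂) ↠ ℂ_{ξ₂}`).  Dictionary proved inside:
`ξ_v (g, u) = ξ₂ g · χH₁ u` (★ `xiLocalChar_apply_eq`; `χH₁ = ψ_v ∘ det₁ = ξ_v ∘ inr`), so ★ `IrrClass.boxChar_mk_ofChar` turns the box of `⟦ℂ_{ξ₂}⟧` into the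
stub's `π₁ = ⟦SmoothIrrep.ofChar (ξ.xiLocalChar v) hker⟧`; `πSt := πSt₂ ⊠ χH₁`.
* §1 generic: `isOpen_ker_of_continuous_unitsComplex` (non-archimedean `G`), `forall_not_bot_lt_lt_top_of_orderIso`.
* §2 `hLengthTwoLabels_and_smoothTrace_of_uTwo` — the assembly over VARIABLE characters `χH₂, χH₁, ξ_v, ξ₂` (every carrier in the ★ `cmDatum … .Local v`
  spelling; with the concrete characters `let`-bound the elaborator exceeds the default heartbeats, hence this factoring); admissibility of
  `i_H(χH₂ ⊠ χH₁)` is ★ `isAdmissible_cmPrincipalSeriesH` (B-p18 (g31)), `IrrClass.comap_refl` is ★ `IrreducibleClassesComapInner`.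
* §3 `hPrincipalSeriesJH_of_uTwo` — the dictionary `ξ_v(g, u) = ξ₂(g) χH₁(u)` and the open kernels, then §2.
HONEST LABEL: HC_CM is proved only modulo the 2 remaining named inputs (hLiu418, h413) until rung 0 closes; (JH₂) is NOT proved here (road H1∕H3∕H4).
References: [Rogawski1990, §12.1 pp. 171–172, §12.7 Cor. 12.7.4 (proof) p. 188]; [BernsteinZelevinsky1976, §2]; [Casselman1995, Cor. 7.1.2].
-/

set_option autoImplicit false
set_option linter.dupNamespace false

noncomputable section

open NumberField IsDedekindDomain MeasureTheory Topology
open scoped Matrix MatrixGroups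
open Literature.NumberTheory.Rogawski1990 Literature.NumberTheory.Automorphic Literature.NumberTheory.Automorphic.UnitaryGroup
open Literature.NumberTheory.GaloisRepresentations

namespace Summit.HodgeConjecture.HodgeConjecture.Cruxes.H413.F0P3bHPrincipalSeriesJHOfUTwo

open Summit.HodgeConjecture.HodgeConjecture.Cruxes.H413.F0P3bPrincipalSeriesTrace
open Summit.HodgeConjecture.HodgeConjecture.Cruxes.H413.F0P3bCharDistReduction

universe u

/-! ## §1 Generic plumbing -/

section Generic

/-- A continuous character `ξ : G →* ℂˣ` of a non-archimedean group has OPEN KERNEL (it is locally constant, ★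
`MonoidHom.isLocallyConstant_of_continuous_unitsComplex`). [cite: CartierCorvallis1979, §I.1] -/
theorem isOpen_ker_of_continuous_unitsComplex {G : Type u} [Group G] [TopologicalSpace G] [NonarchimedeanGroup G] (ξ : G →* ℂˣ)
    (hξ : Continuous fun x => (ξ x : ℂ)) : IsOpen ((ξ.ker : Subgroup G) : Set G) := by
  have h := ξ.isLocallyConstant_of_continuous_unitsComplex hξ
  have hset : ((ξ.ker : Subgroup G) : Set G) = (fun x => (ξ x : ℂ)) ⁻¹' {1} := by
    ext x
    simp only [SetLike.mem_coe, MonoidHom.mem_ker, Set.mem_preimage, Set.mem_singleton_iff, Units.val_eq_one]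
  rw [hset]
  exact h.isOpen_fiber 1

/-- No chain `⊥ < a₁ < a₂ < ⊤` on one side of an order isomorphism if none on the other. [folklore] -/
theorem forall_not_bot_lt_lt_top_of_orderIso {α β : Type*} [PartialOrder α] [BoundedOrder α] [PartialOrder β] [BoundedOrder β] (e : α ≃o β)
    (h : ∀ b₁ b₂ : β, ¬ (⊥ < b₁ ∧ b₁ < b₂ ∧ b₂ < ⊤)) : ∀ a₁ a₂ : α, ¬ (⊥ < a₁ ∧ a₁ < a₂ ∧ a₂ < ⊤) := by
  rintro a₁ a₂ ⟨h₁, h₂, h₃⟩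
  refine h (e a₁) (e a₂) ⟨?_, e.lt_iff_lt.2 h₂, ?_⟩
  · rw [← e.map_bot]; exact e.lt_iff_lt.2 h₁
  · rw [← e.map_top]; exact e.lt_iff_lt.2 h₃

end Generic

/-! ## §2 The assembly over VARIABLE characters (all carriers in the ★ `cmDatum … .Local v` spelling) -/

section Assembly

variable (L : Type) [Field L] [NumberField L] [IsCMField L] (v : HeightOneSpectrum (𝓞 ↥(maximalRealSubfield L)))

set_option maxHeartbeats 800000 in  -- the two carrier spellings of `U(Φ₂)_v` (`(cmDatum …).Local v` ∕ `↥(unitaryGroupOfForm …)`) meet here; 4× default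
/-- **Labels and additivity on `H_v` from labels and length on `U(Φ₂)_v`, for VARIABLE characters**: given a torus character `χH₂`, characters
`χH₁` of `U(Φ₁)_v`, `ξ_v` of `H_v` and `ξ₂` of `U(Φ₂)_v` with open kernels and `ξ_v(g, u) = ξ₂(g) χH₁(u)`, if the constituents of `i(χH₂)` are exactly
`{⟦ℂ_{ξ₂}⟧, πSt₂}` (`πSt₂ ≠ ⟦ℂ_{ξ₂}⟧`) and `i(χH₂)` has no chain `⊥ < N₁ < N₂ < ⊤`, then `HLengthTwoLabels L v χH₂ χH₁ ⟦ℂ_{ξ_v}⟧ (πSt₂ ⊠ χH₁)` and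
`Tr i_H(χH₂ ⊠ χH₁)(f) = Tr ℂ_{ξ_v}(f) + Tr (πSt₂ ⊠ χH₁)(f)` (★ H0 `hLengthTwoLabels_boxChar`, ★ `boxChar_mk_ofChar`, ★ `smoothTrace_comp_eq_add_of_constituents_eq_pair`
at `e := refl`, admissibility by ★ Iwasawa, length through ★ `subrepresentationCMPrincipalSeriesHOrderIso`). [cite: Rogawski1990, §12.1 pp. 171–172] [cite: Casselman1995, Cor. 7.1.2] -/
theorem hLengthTwoLabels_and_smoothTrace_of_uTwo
    [MeasurableSpace (((cmDatum L 2 (Matrix.of fun i j : Fin 2 => if i.val + j.val + 1 = 2 then (1 : L) else 0)).Local v) × ((cmDatum L 1 (Matrix.of fun i j : Fin 1 => if i.val + j.val + 1 = 1 then (1 : L) else 0)).Local v))] [BorelSpace (((cmDatum L 2 (Matrix.of fun i j : Fin 2 => if i.val + j.val + 1 = 2 then (1 : L) else 0)).Local v) × ((cmDatum L 1 (Matrix.of fun i j : Fin 1 => if i.val + j.val + 1 = 1 then (1 : L) else 0)).Local v))]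
    (νH : Measure (((cmDatum L 2 (Matrix.of fun i j : Fin 2 => if i.val + j.val + 1 = 2 then (1 : L) else 0)).Local v) × ((cmDatum L 1 (Matrix.of fun i j : Fin 1 => if i.val + j.val + 1 = 1 then (1 : L) else 0)).Local v))) [νH.IsHaarMeasure] [νH.IsMulRightInvariant]
    (χH₂ : ↥(torusU (conjLocal L (IsCMField.complexConj L) v) (cmLocalForm L 2 v)) →* ℂˣ)
    (χH₁ : ((cmDatum L 1 (Matrix.of fun i j : Fin 1 => if i.val + j.val + 1 = 1 then (1 : L) else 0)).Local v) →* ℂˣ) (hχH₁ : IsOpen (((χH₁.ker : Subgroup _) : Set ((cmDatum L 1 (Matrix.of fun i j : Fin 1 => if i.val + j.val + 1 = 1 then (1 : L) else 0)).Local v))))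
    (ξv : ((cmDatum L 2 (Matrix.of fun i j : Fin 2 => if i.val + j.val + 1 = 2 then (1 : L) else 0)).Local v) × ((cmDatum L 1 (Matrix.of fun i j : Fin 1 => if i.val + j.val + 1 = 1 then (1 : L) else 0)).Local v) →* ℂˣ) (hkerv : IsOpen (((ξv.ker : Subgroup _) : Set (((cmDatum L 2 (Matrix.of fun i j : Fin 2 => if i.val + j.val + 1 = 2 then (1 : L) else 0)).Local v) × ((cmDatum L 1 (Matrix.of fun i j : Fin 1 => if i.val + j.val + 1 = 1 then (1 : L) else 0)).Local v)))))
    (ξ₂ : ((cmDatum L 2 (Matrix.of fun i j : Fin 2 => if i.val + j.val + 1 = 2 then (1 : L) else 0)).Local v) →* ℂˣ) (hξ₂ : IsOpen (((ξ₂.ker : Subgroup _) : Set ((cmDatum L 2 (Matrix.of fun i j : Fin 2 => if i.val + j.val + 1 = 2 then (1 : L) else 0)).Local v))))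
    (hdict : ∀ g : ((cmDatum L 2 (Matrix.of fun i j : Fin 2 => if i.val + j.val + 1 = 2 then (1 : L) else 0)).Local v) × ((cmDatum L 1 (Matrix.of fun i j : Fin 1 => if i.val + j.val + 1 = 1 then (1 : L) else 0)).Local v), ξv g = ξ₂ g.1 * χH₁ g.2)
    (πSt₂ : IrrClass ((cmDatum L 2 (Matrix.of fun i j : Fin 2 => if i.val + j.val + 1 = 2 then (1 : L) else 0)).Local v)) (hne₂ : πSt₂ ≠ IrrClass.mk (SmoothIrrep.ofChar ξ₂ hξ₂))
    (hJH₂' : ∀ c : IrrClass ((cmDatum L 2 (Matrix.of fun i j : Fin 2 => if i.val + j.val + 1 = 2 then (1 : L) else 0)).Local v),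
      c.IsConstituentOf (haveI := locallyCompactSpace_cmBorelU L 2 v; cmPrincipalSeries L 2 v χH₂) ↔ (c = IrrClass.mk (SmoothIrrep.ofChar ξ₂ hξ₂) ∨ c = πSt₂))
    (hlen₂ : ∀ N₁ N₂ : Subrepresentation (haveI := locallyCompactSpace_cmBorelU L 2 v; cmPrincipalSeries L 2 v χH₂), ¬ (⊥ < N₁ ∧ N₁ < N₂ ∧ N₂ < ⊤)) :
    HLengthTwoLabels L v χH₂ χH₁ (IrrClass.mk (SmoothIrrep.ofChar ξv hkerv)) (IrrClass.boxChar χH₁ hχH₁ πSt₂) ∧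
      ∀ fH : ((cmDatum L 2 (Matrix.of fun i j : Fin 2 => if i.val + j.val + 1 = 2 then (1 : L) else 0)).Local v) × ((cmDatum L 1 (Matrix.of fun i j : Fin 1 => if i.val + j.val + 1 = 1 then (1 : L) else 0)).Local v) → ℂ, IsLocSmooth fH →
        Representation.smoothTrace (cmPrincipalSeriesH L v χH₂ χH₁) νH fH =
          (IrrClass.mk (SmoothIrrep.ofChar ξv hkerv)).smoothTrace νH fH + (IrrClass.boxChar χH₁ hχH₁ πSt₂).smoothTrace νH fH := by
  -- the labels on `H_v` (★ H0), the first one rewritten to `⟦ℂ_{ξ_v}⟧`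
  have hlab := hLengthTwoLabels_boxChar L v χH₂ χH₁ hχH₁ hne₂ hJH₂'
  rw [IrrClass.boxChar_mk_ofChar ξ₂ hξ₂ χH₁ hχH₁ ξv hkerv hdict] at hlab
  refine ⟨hlab, fun fH _ => ?_⟩
  -- admissibility of `i_H(χH₂ ⊠ χH₁)` (★ `isAdmissible_cmPrincipalSeriesH`: Iwasawa ⇒ `i(χH₂)` admissible ⇒ its box with `χH₁`)
  have hadm : (cmPrincipalSeriesH L v χH₂ χH₁).IsAdmissible := isAdmissible_cmPrincipalSeriesH L v χH₂ χH₁ hχH₁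
  -- length ≤ 2 transported along ★ `subrepresentationCMPrincipalSeriesHOrderIso`
  have hlenH := forall_not_bot_lt_lt_top_of_orderIso (subrepresentationCMPrincipalSeriesHOrderIso L v χH₂ χH₁) hlen₂
  -- additivity at `e := refl`
  have hadd := smoothTrace_comp_eq_add_of_constituents_eq_pair (cmPrincipalSeriesH L v χH₂ χH₁) hadm hlenH
    (IrrClass.boxChar χH₁ hχH₁ πSt₂) (IrrClass.mk (SmoothIrrep.ofChar ξv hkerv)) hlab.1 hlab.2 (ContinuousMulEquiv.refl _) νH fH
  have hcomp : (cmPrincipalSeriesH L v χH₂ χH₁).comp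
      (ContinuousMulEquiv.refl (((cmDatum L 2 (Matrix.of fun i j : Fin 2 => if i.val + j.val + 1 = 2 then (1 : L) else 0)).Local v) × ((cmDatum L 1 (Matrix.of fun i j : Fin 1 => if i.val + j.val + 1 = 1 then (1 : L) else 0)).Local v))).toMulEquiv.toMonoidHom = cmPrincipalSeriesH L v χH₂ χH₁ :=
    MonoidHom.comp_id _
  rw [hcomp, IrrClass.comap_refl, IrrClass.comap_refl, add_comm] at hadd
  exact hadd

end Assembly

/-! ## §3 (N-H-ii′) from (JH₂) -/

section CM

set_option maxHeartbeats 800000 in  -- statement-level `whnf` on the CM carriers (same budget class as ★ `isAdmissible_cmPrincipalSeriesH`)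
/-- **(N-H-ii′) ⇐ (JH₂)** — the text of `stub_hPrincipalSeriesJH` (line «CMCharIdentityTest» ED. 11 :482–506, abbreviations `Pl`∕`HLoc` unfolded;
by-paste fold certificate GREEN) follows from the Jordan–Hölder statement (JH₂) for `i(χH₂) = cmPrincipalSeries L 2 v χH₂` on `U(Φ₂)(L⁺_v)`
ALONE: `∃ πSt₂ ≠ ⟦ℂ_{ξ₂}⟧` (`ξ₂ := ξ_v ∘ inl`) with constituents EXACTLY `{⟦ℂ_{ξ₂}⟧, πSt₂}` and no chain `⊥ < N₁ < N₂ < ⊤`.  Proof: open kernels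
(`ξ_v`, `ξ₂`, `χH₁ = ψ_v ∘ det₁` are continuous on non-archimedean groups), the dictionary `ξ_v (g, u) = ξ₂ g · χH₁ u` (★ `xiLocalChar_apply_eq`
at `(1, u)`, `det₂ 1 = 1`), then `hLengthTwoLabels_and_smoothTrace_of_uTwo` with `πSt := πSt₂ ⊠ χH₁`.
[cite: Rogawski1990, §12.1 case (1) pp. 171–172; §12.7 Cor. 12.7.4 (proof) p. 188] [cite: Casselman1995, Cor. 7.1.2] -/
theorem hPrincipalSeriesJH_of_uTwo
    (hJH₂ : ∀ (L : Type) [Field L] [NumberField L] [IsCMField L] (v : HeightOneSpectrum (𝓞 ↥(maximalRealSubfield L))) (ξ : OneDimAutRepH L),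
      (∀ w : PlacesOver L v, IsCMField.complexConj L • w.1 = w.1) →
      ∀ hξ₂ : IsOpen (((((ξ.xiLocalChar v).comp (MonoidHom.inl ((cmDatum L 2 (Matrix.of fun i j : Fin 2 => if i.val + j.val + 1 = 2 then (1 : L) else 0)).Local v) ((cmDatum L 1 (Matrix.of fun i j : Fin 1 => if i.val + j.val + 1 = 1 then (1 : L) else 0)).Local v))).ker :
          Subgroup ((cmDatum L 2 (Matrix.of fun i j : Fin 2 => if i.val + j.val + 1 = 2 then (1 : L) else 0)).Local v)) : Set ((cmDatum L 2 (Matrix.of fun i j : Fin 2 => if i.val + j.val + 1 = 2 then (1 : L) else 0)).Local v))),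
      ∃ πSt₂ : IrrClass ((cmDatum L 2 (Matrix.of fun i j : Fin 2 => if i.val + j.val + 1 = 2 then (1 : L) else 0)).Local v),
        πSt₂ ≠ IrrClass.mk (SmoothIrrep.ofChar ((ξ.xiLocalChar v).comp (MonoidHom.inl ((cmDatum L 2 (Matrix.of fun i j : Fin 2 => if i.val + j.val + 1 = 2 then (1 : L) else 0)).Local v) ((cmDatum L 1 (Matrix.of fun i j : Fin 1 => if i.val + j.val + 1 = 1 then (1 : L) else 0)).Local v))) hξ₂) ∧
        (∀ c : IrrClass ((cmDatum L 2 (Matrix.of fun i j : Fin 2 => if i.val + j.val + 1 = 2 then (1 : L) else 0)).Local v),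
          c.IsConstituentOf (haveI := locallyCompactSpace_cmBorelU L 2 v; cmPrincipalSeries L 2 v
            (torusCharPair (conjLocal L (IsCMField.complexConj L) v) (cmLocalForm L 2 v) (cmLocalForm_eq_over L 2 v) 0
            ((torusLocalComponent L (IsCMField.complexConj L) v ξ.η).comp
                (quotConj (conjLocal L (IsCMField.complexConj L) v) (conjLocal_conjLocal_cm L v)) *
              halfModulusChar (UnitaryGroup.LocalRing L v))
            (torusLocalComponent L (IsCMField.complexConj L) v ξ.ψ))) ↔
            (c = IrrClass.mk (SmoothIrrep.ofChar ((ξ.xiLocalChar v).comp (MonoidHom.inl ((cmDatum L 2 (Matrix.of fun i j : Fin 2 => if i.val + j.val + 1 = 2 then (1 : L) else 0)).Local v) ((cmDatum L 1 (Matrix.of fun i j : Fin 1 => if i.val + j.val + 1 = 1 then (1 : L) else 0)).Local v))) hξ₂) ∨ c = πSt₂)) ∧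
        (∀ N₁ N₂ : Subrepresentation (haveI := locallyCompactSpace_cmBorelU L 2 v; cmPrincipalSeries L 2 v
            (torusCharPair (conjLocal L (IsCMField.complexConj L) v) (cmLocalForm L 2 v) (cmLocalForm_eq_over L 2 v) 0
            ((torusLocalComponent L (IsCMField.complexConj L) v ξ.η).comp
                (quotConj (conjLocal L (IsCMField.complexConj L) v) (conjLocal_conjLocal_cm L v)) *
              halfModulusChar (UnitaryGroup.LocalRing L v))
            (torusLocalComponent L (IsCMField.complexConj L) v ξ.ψ))),
          ¬ (⊥ < N₁ ∧ N₁ < N₂ ∧ N₂ < ⊤))) :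
  ∀ (L : Type) [Field L] [NumberField L] [IsCMField L] (v : HeightOneSpectrum (𝓞 ↥(maximalRealSubfield L)))
    [MeasurableSpace (((cmDatum L 2 (Matrix.of fun i j : Fin 2 => if i.val + j.val + 1 = 2 then (1 : L) else 0)).Local v) × ((cmDatum L 1 (Matrix.of fun i j : Fin 1 => if i.val + j.val + 1 = 1 then (1 : L) else 0)).Local v))] [BorelSpace (((cmDatum L 2 (Matrix.of fun i j : Fin 2 => if i.val + j.val + 1 = 2 then (1 : L) else 0)).Local v) × ((cmDatum L 1 (Matrix.of fun i j : Fin 1 => if i.val + j.val + 1 = 1 then (1 : L) else 0)).Local v))]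
    (νH : Measure (((cmDatum L 2 (Matrix.of fun i j : Fin 2 => if i.val + j.val + 1 = 2 then (1 : L) else 0)).Local v) × ((cmDatum L 1 (Matrix.of fun i j : Fin 1 => if i.val + j.val + 1 = 1 then (1 : L) else 0)).Local v))) [νH.IsHaarMeasure] [νH.IsMulRightInvariant]
    (ξ : OneDimAutRepH L), (∀ w : PlacesOver L v, IsCMField.complexConj L • w.1 = w.1) →
      ∃ πSt : IrrClass (((cmDatum L 2 (Matrix.of fun i j : Fin 2 => if i.val + j.val + 1 = 2 then (1 : L) else 0)).Local v) × ((cmDatum L 1 (Matrix.of fun i j : Fin 1 => if i.val + j.val + 1 = 1 then (1 : L) else 0)).Local v)),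
        ∃ hker : IsOpen ((((ξ.xiLocalChar v).ker : Subgroup (((cmDatum L 2 (Matrix.of fun i j : Fin 2 => if i.val + j.val + 1 = 2 then (1 : L) else 0)).Local v) × ((cmDatum L 1 (Matrix.of fun i j : Fin 1 => if i.val + j.val + 1 = 1 then (1 : L) else 0)).Local v))) : Set (((cmDatum L 2 (Matrix.of fun i j : Fin 2 => if i.val + j.val + 1 = 2 then (1 : L) else 0)).Local v) × ((cmDatum L 1 (Matrix.of fun i j : Fin 1 => if i.val + j.val + 1 = 1 then (1 : L) else 0)).Local v)))),
        HLengthTwoLabels L v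
          (torusCharPair (conjLocal L (IsCMField.complexConj L) v) (cmLocalForm L 2 v) (cmLocalForm_eq_over L 2 v) 0
            ((torusLocalComponent L (IsCMField.complexConj L) v ξ.η).comp
                (quotConj (conjLocal L (IsCMField.complexConj L) v) (conjLocal_conjLocal_cm L v)) *
              halfModulusChar (UnitaryGroup.LocalRing L v))
            (torusLocalComponent L (IsCMField.complexConj L) v ξ.ψ))
          ((torusLocalComponent L (IsCMField.complexConj L) v ξ.ψ).comp (localDet (IsCMField.complexConj L) v (isUnit_antidiagOne_det L 1)))
            (IrrClass.mk (SmoothIrrep.ofChar (ξ.xiLocalChar v) hker)) πSt ∧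
        (∀ fH : ((cmDatum L 2 (Matrix.of fun i j : Fin 2 => if i.val + j.val + 1 = 2 then (1 : L) else 0)).Local v) × ((cmDatum L 1 (Matrix.of fun i j : Fin 1 => if i.val + j.val + 1 = 1 then (1 : L) else 0)).Local v) → ℂ, IsLocSmooth fH →
          Representation.smoothTrace
              (UnitaryGroup.cmPrincipalSeriesH L v
                (torusCharPair (conjLocal L (IsCMField.complexConj L) v) (cmLocalForm L 2 v) (cmLocalForm_eq_over L 2 v) 0
            ((torusLocalComponent L (IsCMField.complexConj L) v ξ.η).comp
                (quotConj (conjLocal L (IsCMField.complexConj L) v) (conjLocal_conjLocal_cm L v)) *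
              halfModulusChar (UnitaryGroup.LocalRing L v))
            (torusLocalComponent L (IsCMField.complexConj L) v ξ.ψ))
                ((torusLocalComponent L (IsCMField.complexConj L) v ξ.ψ).comp (localDet (IsCMField.complexConj L) v (isUnit_antidiagOne_det L 1))))
              νH fH =
            (IrrClass.mk (SmoothIrrep.ofChar (ξ.xiLocalChar v) hker)).smoothTrace νH fH + πSt.smoothTrace νH fH) := by
  intro L _ _ _ v _ _ νH _ _ ξ hns
  -- non-archimedean carriers, open kernels
  haveI := nonarchimedeanGroup_HLoc L v
  haveI : NonarchimedeanGroup ((cmDatum L 2 (Matrix.of fun i j : Fin 2 => if i.val + j.val + 1 = 2 then (1 : L) else 0)).Local v) :=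
    nonarchimedeanGroup_unitaryGroupOfForm_local (E := L) (c := IsCMField.complexConj L) (N := 2) (v := v)
      (J' := (adelicForm L 2 (Matrix.of fun i j : Fin 2 => if i.val + j.val + 1 = 2 then (1 : L) else 0)).map (adeleToLocal L v))
  haveI : NonarchimedeanGroup ((cmDatum L 1 (Matrix.of fun i j : Fin 1 => if i.val + j.val + 1 = 1 then (1 : L) else 0)).Local v) :=
    nonarchimedeanGroup_unitaryGroupOfForm_local (E := L) (c := IsCMField.complexConj L) (N := 1) (v := v)
      (J' := (adelicForm L 1 (Matrix.of fun i j : Fin 1 => if i.val + j.val + 1 = 1 then (1 : L) else 0)).map (adeleToLocal L v))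
  have hξvc : Continuous fun h => ((ξ.xiLocalChar v h : ℂˣ) : ℂ) := OneDimAutRepH.continuous_xiLocalChar ξ v
  have hkerv : IsOpen ((((ξ.xiLocalChar v).ker : Subgroup _) : Set (((cmDatum L 2 (Matrix.of fun i j : Fin 2 => if i.val + j.val + 1 = 2 then (1 : L) else 0)).Local v) × ((cmDatum L 1 (Matrix.of fun i j : Fin 1 => if i.val + j.val + 1 = 1 then (1 : L) else 0)).Local v)))) :=
    isOpen_ker_of_continuous_unitsComplex _ hξvc
  have hξ₂ : IsOpen (((((ξ.xiLocalChar v).comp (MonoidHom.inl ((cmDatum L 2 (Matrix.of fun i j : Fin 2 => if i.val + j.val + 1 = 2 then (1 : L) else 0)).Local v) ((cmDatum L 1 (Matrix.of fun i j : Fin 1 => if i.val + j.val + 1 = 1 then (1 : L) else 0)).Local v))).ker :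
      Subgroup _) : Set ((cmDatum L 2 (Matrix.of fun i j : Fin 2 => if i.val + j.val + 1 = 2 then (1 : L) else 0)).Local v))) :=
    isOpen_ker_of_continuous_unitsComplex _ (hξvc.comp (continuous_id.prodMk continuous_const))
  have hχH₁ := isOpen_ker_of_continuous_unitsComplex (G := ((cmDatum L 1 (Matrix.of fun i j : Fin 1 => if i.val + j.val + 1 = 1 then (1 : L) else 0)).Local v))
    ((torusLocalComponent L (IsCMField.complexConj L) v ξ.ψ).comp (localDet (IsCMField.complexConj L) v (isUnit_antidiagOne_det L 1)))
    ((continuous_torusLocalComponent L (IsCMField.complexConj L) (v := v) ξ.ψ).comp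
      (continuous_localDet (IsCMField.complexConj L) v (isUnit_antidiagOne_det L 1)
        (J := Matrix.of fun i j : Fin 1 => if i.val + j.val + 1 = 1 then (1 : L) else 0)))
  -- (JH₂) (two steps: a direct `obtain … := hJH₂ …` exceeds the default heartbeats)
  have hJH₂v := hJH₂ L v ξ hns hξ₂
  obtain ⟨πSt₂, hne₂, hJH₂', hlen₂⟩ := hJH₂v
  -- dictionary `ξ_v (g, u) = ξ₂ g · χH₁ u` (through `(g, u) = (g, 1)(1, u)`; `det₂ 1 = 1` stated at the `cmDatum` spelling)
  have h2 : localDet (IsCMField.complexConj L) v (isUnit_antidiagOne_det L 2)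
      (J := Matrix.of fun i j : Fin 2 => if i.val + j.val + 1 = 2 then (1 : L) else 0)
      (1 : ((cmDatum L 2 (Matrix.of fun i j : Fin 2 => if i.val + j.val + 1 = 2 then (1 : L) else 0)).Local v)) = 1 :=
    map_one _
  have hdict : ∀ g : ((cmDatum L 2 (Matrix.of fun i j : Fin 2 => if i.val + j.val + 1 = 2 then (1 : L) else 0)).Local v) × ((cmDatum L 1 (Matrix.of fun i j : Fin 1 => if i.val + j.val + 1 = 1 then (1 : L) else 0)).Local v),
      ξ.xiLocalChar v g = ((ξ.xiLocalChar v).comp (MonoidHom.inl ((cmDatum L 2 (Matrix.of fun i j : Fin 2 => if i.val + j.val + 1 = 2 then (1 : L) else 0)).Local v) ((cmDatum L 1 (Matrix.of fun i j : Fin 1 => if i.val + j.val + 1 = 1 then (1 : L) else 0)).Local v))) g.1 *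
        ((torusLocalComponent L (IsCMField.complexConj L) v ξ.ψ).comp (localDet (IsCMField.complexConj L) v (isUnit_antidiagOne_det L 1))) g.2 := by
    intro g
    have e1 : ξ.xiLocalChar v g = ξ.xiLocalChar v (g.1, 1) * ξ.xiLocalChar v (1, g.2) := by
      conv_lhs => rw [← Prod.fst_mul_snd g]
      exact map_mul _ _ _
    have e2 : ξ.xiLocalChar v (1, g.2) =
        ((torusLocalComponent L (IsCMField.complexConj L) v ξ.ψ).comp (localDet (IsCMField.complexConj L) v (isUnit_antidiagOne_det L 1))) g.2 := by
      rw [OneDimAutRepH.xiLocalChar_apply_eq ξ v (1, g.2), MonoidHom.comp_apply]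
      change torusLocalComponent L (IsCMField.complexConj L) v ξ.η
            (localDet (IsCMField.complexConj L) v (isUnit_antidiagOne_det L 2)
              (J := Matrix.of fun i j : Fin 2 => if i.val + j.val + 1 = 2 then (1 : L) else 0)
              (1 : ((cmDatum L 2 (Matrix.of fun i j : Fin 2 => if i.val + j.val + 1 = 2 then (1 : L) else 0)).Local v))) *
          torusLocalComponent L (IsCMField.complexConj L) v ξ.ψ
            (localDet (IsCMField.complexConj L) v (isUnit_antidiagOne_det L 2)
                (J := Matrix.of fun i j : Fin 2 => if i.val + j.val + 1 = 2 then (1 : L) else 0)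
                (1 : ((cmDatum L 2 (Matrix.of fun i j : Fin 2 => if i.val + j.val + 1 = 2 then (1 : L) else 0)).Local v)) *
              localDet (IsCMField.complexConj L) v (isUnit_antidiagOne_det L 1) g.2) = _
      rw [h2, (torusLocalComponent L (IsCMField.complexConj L) v ξ.η).map_one, one_mul, one_mul]
    rw [e1, e2, MonoidHom.comp_apply]
    rfl
  obtain ⟨hlab, hadd⟩ := hLengthTwoLabels_and_smoothTrace_of_uTwo L v νH _ _ hχH₁ (ξ.xiLocalChar v) hkerv _ hξ₂ hdict πSt₂ hne₂ hJH₂' hlen₂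
  exact ⟨_, hkerv, hlab, hadd⟩

end CM

end Summit.HodgeConjecture.HodgeConjecture.Cruxes.H413.F0P3bHPrincipalSeriesJHOfUTwo

end
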